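import Summits.ABC.IUTFork.Thm311RealInd1StripHull
import Summits.ABC.IUTFork.Thm311RealInd1StripPlaneReach
import HarnessLib

/-!
# [IUTchIII] Thm 3.11 (i) (Ind1)+(Ind2) at `v ∈ 𝕍^non`: the hull FLOOR — modulo `JannsenWingbergMappingClass`, for regions in general position at
# a tame place of odd local degree `≥ 3`, the `𝒪_{K_v}`-hull of print's (Ind1)⊔(Ind2) orbit span EQUALS Dupuy–Hilado's container hull

PROOF-ONLY file (abc-iut cell, Cor. 3.12 sub-crew, seat abc-iut-c312-1 = holder of record of the typed [IUTchIII] Thm. 3.11, gen 15; row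
«R19 = C:IND1-STRIP-OV-HULL», C LEAD ruling C-R120 (c); the conditional half announced in `Thm311RealInd1StripHull`).  TAKES NO SIDE on
[IUTchIII] Cor. 3.12.

* **`exists_basis_hullFloor_of_jannsenWingbergMappingClass`** (binder `hMC : JannsenWingbergMappingClass`; `p > 2`, `e(v|p) ≤ p − 2`,
  `[K_v:ℚ_p] = 1 + 2g ≥ 3` odd).  With the basis `y` of `K_v^{(1/n_v)}` and the realised `Sp_{2g}(ℤ)` of gen 14's
  `exists_planeReach_of_jannsenWingbergMappingClass` (p524057):
  (T) the TRACE STRUCTURE of that basis, derived here with NO new fact — every plane vector `y_{pl k}` is trace-zero (the realised symplectic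
  transvection `ψ_{T_{e_k}}` moves `y_{k̄}` by `±y_k`, and strip automorphisms preserve `Tr_{K_v/ℚ_p}`: R13 `trace_apply_eq_of_mem_ind1StripOf`,
  UNCONDITIONAL), `Tr(y_{inl 0}) ≠ 0` (else `Tr ≡ 0`, but `Tr(1) = [K_v:ℚ_p]`), hence the `y_{inl 0}`-coordinate of every trace-zero vector vanishes;
  (B) the BOX property of `log_p(𝒪_v^×)` in that basis — every plane coordinate of a log-unit times every plane vector is a log-unit (plane
  reach with `M = N = log_p(𝒪_v^×)`; cf. R18a p519532 for the Jannsen–Wingberg basis), and (R) the reconstruction identity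
  `z = y^*_{inl 0}(z)·y_{inl 0} + Σ_k y^*_{pl k}(z)·y_{pl k}` in Kondo's plane indexing `pl`;
  (H) for every `c ∈ ℚ_p`, every `ℤ_p`-stable region `M ⊆ K_v` in GENERAL POSITION w.r.t. `y` — some plane coordinate of some element of `M` has
  norm `≥` every plane coordinate of every element of `c·log_p(𝒪_v^×)` — and every additive subgroup `N ∋ M` closed under the two-step strip
  orbit (`x, ψ x, ψ'(ψ x)` for `ψ, ψ' ∈ Real.ind1StripOf v (galoisLog v)`): the FLOOR `c·(log_p(𝒪_v^×) ∩ Ker Tr) ⊆ N` (plane reach fed with the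
  general-position quotient `u = y^*_k(c z)/y^*_{j₀}(x₀) ∈ ℤ_p`), `N` contains an element of the container radius `‖c‖·p^{−1/e}` (the co-radial
  trace-zero element of `Literature…TraceZeroCoradial`), and — if `M ⊆ c·log_p(𝒪_v^×)` and `N` lies inside the ceiling `M + (c·log_p(𝒪_v^×) ∩ Ker Tr)`
  (p516833 §1: the orbit span does) — the `𝒪_{K_v}`-MODULE HULLS of `N` and of Dupuy–Hilado's container span `c·log_p(𝒪_v^×)` are EQUAL
  (`= closedBall 0 (‖c‖·p^{−1/e})`, `Thm311RealInd1StripHull` §0–§1).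
READING (numbers about OUR typed objects, one finite place): modulo the Jannsen–Wingberg presentation with Kondo's mapping-class-group image,
at a tame place of odd local degree `≥ 3`, for every region in general position, the holomorphic hull ([IUTchIII] Rmk. 3.9.5; Step (xi) of
Cor. 3.12) of the print-(Ind1)⊔(Ind2) orbit span AS TYPED is EXACTLY the hull of Dupuy–Hilado's container orbit span — the container is not an
over-count relative to print's own single-place indeterminacies there; the unconditional half (ceiling hull = container hull) is
`Thm311RealInd1StripHull`.  General position is automatic for ideal-shaped regions `𝔪_v^n` off one residue (sequel).  HONEST SCOPE: conditional on
`hMC` (Kondo 2025 §3 over Farb–Margalit Thm. 6.4 + Jannsen–Wingberg; flag (α)); single place; tame; odd local degree (the even-degree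
mapping-class analogue has no printed sentence); OUR typing of print's (Ind1) (THE lift, THE logarithm; F-B28-1 untouched); nothing here computes
a tensor-packet hull or a log-volume; no side taken on [IUTchIII] Cor. 3.12; NO abc claim. [claim: Mochizuki2012, status: disputed];
[cite: Mochizuki2012, IUTchIII Rmk. 3.9.5 (i) p. 126; Thm. 3.11 (i) p. 154; Cor. 3.12 Step (xi) p. 183; IUTchIV Prop. 1.2 (i) p. 10];
[cite: Kondo2025OuterAutMLF, §3 Thm 3.17, Rem 3.18]; [cite: FarbMargalit2012, Thm 6.4 p.147]; [cite: HoshiNishio2022OuterAutMLF, Lemma 2.3 (ii)];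
[cite: DupuyHilado2025, §4.9, §4.12]. typed ≠ proved; a conditional theorem discharges nothing it binds.
-/

set_option autoImplicit false

noncomputable section

open Metric Set
open scoped Pointwise

namespace Summit.ABC.IUTFork.Thm311.Real

open NumberField IsDedekindDomain Literature.NumberTheory.NumberFields Literature.IUT.LogVolume
open Literature.NumberTheory.GaloisRepresentations Literature.NumberTheory.GaloisRepresentations.Ultrametric
open Literature.AnabelianGeometry.AbsoluteAnabelian Literature.IUT.HodgeArakelov
open Literature.IUT.HodgeArakelov.AbsTopMonoids Matrix

variable {F : Type} [Field F] [NumberField F] (v : HeightOneSpectrum (𝓞 F))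

set_option maxHeartbeats 400000 in
/-- **THE HULL FLOOR OF PRINT's (Ind1)⊔(Ind2) ORBIT SPAN (modulo `JannsenWingbergMappingClass`), tame place, odd local degree `≥ 3`.**
With the basis `y` and the realised `Sp_{2g}(ℤ)` of `exists_planeReach_of_jannsenWingbergMappingClass` (p524057): (T) every plane vector is
trace-zero and `Tr(y_{inl 0}) ≠ 0` (from the realised transvections and the UNCONDITIONAL trace rigidity R13 — no new fact); (B) the box
property of `log_p(𝒪_v^×)` in the basis `y` (plane coordinates times plane vectors stay in `log_p(𝒪_v^×)`); (H) for every `c`,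
every `ℤ_p`-stable region `M` in general position (a plane coordinate of `M` of maximal norm among the plane coordinates of `c·log_p(𝒪_v^×)`) and
every additive subgroup `N ∋ M` closed under the two-step strip orbit: `c·(log_p(𝒪_v^×) ∩ Ker Tr) ⊆ N`, `N` contains an element of norm
`‖c‖·p^{−1/e}`, and if `M ⊆ c·log_p(𝒪_v^×)` and `N ⊆ M + (c·log_p(𝒪_v^×) ∩ Ker Tr)` then the `𝒪_{K_v}`-module hulls of `N` and of the container
span `c·log_p(𝒪_v^×)` COINCIDE. [claim: Mochizuki2012, status: disputed] [cite: Mochizuki2012, IUTchIII Thm. 3.11 (i) p. 154; Rmk. 3.9.5 (i) p. 126]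
[cite: Kondo2025OuterAutMLF, §3 Thm 3.17, Rem 3.18] [cite: HoshiNishio2022OuterAutMLF, Lemma 2.3 (ii)] [cite: DupuyHilado2025, §4.9, §4.12] -/
theorem exists_basis_hullFloor_of_jannsenWingbergMappingClass (hMC : JannsenWingbergMappingClass)
    (p : ℕ) [Fact p.Prime] (hv : ((p : ℕ) : 𝓞 F) ∈ v.asIdeal) (hp2 : 2 < p)
    (he : absRamificationIdx p (RescaledCompletion F p v hv) ≤ p - 2) (h3 : 3 ≤ localDeg F v) (hodd : Odd (localDeg F v)) :
    ∃ (g : ℕ) (_ : localDeg F v = 1 + 2 * g) (y : Module.Basis (Fin 1 ⊕ Fin g × Fin 2) ℚ_[p] (RescaledCompletion F p v hv)),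
      (∀ k : Fin g ⊕ Fin g, Algebra.trace ℚ_[p] (RescaledCompletion F p v hv)
          (y (Sum.inr (Sum.elim (fun i => (i, 0)) (fun i => (i, 1)) k))) = 0) ∧
      Algebra.trace ℚ_[p] (RescaledCompletion F p v hv) (y (Sum.inl 0)) ≠ 0 ∧
      (∀ z : RescaledCompletion F p v hv, Algebra.trace ℚ_[p] (RescaledCompletion F p v hv) z = 0 → y.coord (Sum.inl 0) z = 0) ∧
      (∀ z ∈ logUnits (RescaledCompletion F p v hv), ∀ j k : Fin g ⊕ Fin g,
        y.coord (Sum.inr (Sum.elim (fun i => (i, 0)) (fun i => (i, 1)) j)) z •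
          y (Sum.inr (Sum.elim (fun i => (i, 0)) (fun i => (i, 1)) k)) ∈ logUnits (RescaledCompletion F p v hv)) ∧
      (∀ z : RescaledCompletion F p v hv, y.coord (Sum.inl 0) z • y (Sum.inl 0) +
        ∑ k : Fin g ⊕ Fin g, y.coord (Sum.inr (Sum.elim (fun i => (i, 0)) (fun i => (i, 1)) k)) z •
          y (Sum.inr (Sum.elim (fun i => (i, 0)) (fun i => (i, 1)) k)) = z) ∧
      ∀ (c : ℚ_[p]) (M : Set (v.adicCompletion F)) (N : AddSubgroup (RescaledCompletion F p v hv)),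
        (∀ u : ℚ_[p], ‖u‖ ≤ 1 → ∀ x ∈ M, (RescaledCompletion.of F p v hv).symm (u • RescaledCompletion.of F p v hv x) ∈ M) →
        (∃ x₀ ∈ M, ∃ j₀ : Fin g ⊕ Fin g, ∀ z ∈ logUnits (RescaledCompletion F p v hv), ∀ k : Fin g ⊕ Fin g,
          ‖y.coord (Sum.inr (Sum.elim (fun i => (i, 0)) (fun i => (i, 1)) k)) (c • z)‖ ≤
            ‖y.coord (Sum.inr (Sum.elim (fun i => (i, 0)) (fun i => (i, 1)) j₀)) (RescaledCompletion.of F p v hv x₀)‖) →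
        (∀ x ∈ M, RescaledCompletion.of F p v hv x ∈ N) →
        (∀ ψ ∈ ind1StripOf v (galoisLog v), ∀ x ∈ M, RescaledCompletion.of F p v hv (ψ x) ∈ N ∧
          ∀ ψ' ∈ ind1StripOf v (galoisLog v), RescaledCompletion.of F p v hv (ψ' (ψ x)) ∈ N) →
        c • (logUnits (RescaledCompletion F p v hv) ∩ {w | Algebra.trace ℚ_[p] (RescaledCompletion F p v hv) w = 0}) ⊆
            (N : Set (RescaledCompletion F p v hv)) ∧
        (∃ n ∈ N, ‖n‖ = ‖c‖ * (p : ℝ) ^ (-(1 / (absRamificationIdx p (RescaledCompletion F p v hv) : ℝ)))) ∧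
        ((∀ x ∈ M, RescaledCompletion.of F p v hv x ∈ c • logUnits (RescaledCompletion F p v hv)) →
          (N : Set (RescaledCompletion F p v hv)) ⊆ RescaledCompletion.of F p v hv '' M +
            (c • logUnits (RescaledCompletion F p v hv) ∩ {w | Algebra.trace ℚ_[p] (RescaledCompletion F p v hv) w = 0}) →
          (Submodule.span (Valued.integer (RescaledCompletion F p v hv)) (N : Set (RescaledCompletion F p v hv)) :
              Set (RescaledCompletion F p v hv)) =
            Submodule.span (Valued.integer (RescaledCompletion F p v hv)) (c • logUnits (RescaledCompletion F p v hv))) := by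
  -- `p` IS the residue characteristic of `K_v` (for the trace-rigidity lemma of R13)
  obtain rfl : p = (closureAt v).residueChar := eq_residueChar_closureAt_of_natCast_mem v hv
  have hp2' : (closureAt v).residueChar ≠ 2 := hp2.ne'
  obtain ⟨g, hg, y, hSp, hreach⟩ := exists_planeReach_of_jannsenWingbergMappingClass v hMC _ hv hp2' h3 hodd
  set e := RescaledCompletion.of F (closureAt v).residueChar v hv with he_def
  set Tr := Algebra.trace ℚ_[(closureAt v).residueChar] (RescaledCompletion F (closureAt v).residueChar v hv) with hTr_def
  -- notation (as in R18d)
  let pl : Fin g ⊕ Fin g → Fin g × Fin 2 := Sum.elim (fun i => (i, 0)) (fun i => (i, 1))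
  let cz : RescaledCompletion F (closureAt v).residueChar v hv → Fin g ⊕ Fin g → ℚ_[(closureAt v).residueChar] :=
    fun z c => y.coord (Sum.inr (pl c)) z
  let Uy : (Fin g ⊕ Fin g → ℤ) → RescaledCompletion F (closureAt v).residueChar v hv :=
    fun u => ∑ r, (u r : ℚ_[(closureAt v).residueChar]) • y (Sum.inr (pl r))
  let Ω : (Fin g ⊕ Fin g → ℤ) → RescaledCompletion F (closureAt v).residueChar v hv → ℚ_[(closureAt v).residueChar] :=
    fun u z => ∑ c, ((u ᵥ* J (Fin g) ℤ) c : ℚ_[(closureAt v).residueChar]) * cz z c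
  have hcoord : ∀ s t : Fin 1 ⊕ Fin g × Fin 2, y.coord s (y t) = if t = s then 1 else 0 := by
    intro s t
    rw [Module.Basis.coord_apply, Module.Basis.repr_self, Finsupp.single_apply]
  have hpl_inj : Function.Injective pl := by
    rintro (i | i) (i' | i') h <;> simp only [pl, Sum.elim_inl, Sum.elim_inr, Prod.mk.injEq] at h
    · rw [h.1]
    · exact absurd h.2 (by decide)
    · exact absurd h.2 (by decide)
    · rw [h.1]
  let toSum : Fin g × Fin 2 → Fin g ⊕ Fin g := fun iε => ![Sum.inl iε.1, Sum.inr iε.1] iε.2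
  have hpt : ∀ iε, pl (toSum iε) = iε := by
    rintro ⟨i, ε⟩; fin_cases ε <;> rfl
  have htp : ∀ c, toSum (pl c) = c := by rintro (i | i) <;> rfl
  -- (a) reconstruction (adapted from R18d `Thm311RealInd1StripPlaneReach`)
  have hrec : ∀ z : RescaledCompletion F (closureAt v).residueChar v hv,
      y.coord (Sum.inl 0) z • y (Sum.inl 0) + ∑ c, cz z c • y (Sum.inr (pl c)) = z := by
    intro z
    have h := y.sum_repr z
    rw [Fintype.sum_sum_type, Fin.sum_univ_one] at h
    refine Eq.trans ?_ h
    rw [Module.Basis.coord_apply]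
    congr 1
    exact Fintype.sum_equiv ⟨pl, toSum, htp, hpt⟩ (fun c => cz z c • y (Sum.inr (pl c)))
      (fun iε => y.repr z (Sum.inr iε) • y (Sum.inr iε)) fun c => rfl
  -- (b) the transvection formula (adapted from R18d): `e ψ_u e⁻¹ (z) = z + Ω u z • Uy u`
  have hT : ∀ u : Fin g ⊕ Fin g → ℤ, ∃ ψ : v.adicCompletion F ≃+ v.adicCompletion F, ψ ∈ ind1StripOf v (galoisLog v) ∧
      ∀ z, e (ψ (e.symm z)) = z + Ω u z • Uy u := by
    intro u
    obtain ⟨ψ, hψ, hψf⟩ := hSp _ (transvection_mem_symplecticGroup u)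
    refine ⟨ψ, hψ, fun z => ?_⟩
    rw [hψf z]
    set A : Matrix (Fin g ⊕ Fin g) (Fin g ⊕ Fin g) ℤ := 1 + vecMulVec u (u ᵥ* J (Fin g) ℤ) with hAdef
    set w : Fin g ⊕ Fin g → ℤ := u ᵥ* J (Fin g) ℤ with hwdef
    have hent : ∀ r c : Fin g ⊕ Fin g, A r c = (if r = c then 1 else 0) + u r * w c := by
      intro r c
      rw [hAdef, Matrix.add_apply, Matrix.one_apply, vecMulVec_apply]
    have hinner : ∀ c : Fin g ⊕ Fin g,
        ∑ r, (A r c : ℚ_[(closureAt v).residueChar]) • y (Sum.inr (pl r)) =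
          y (Sum.inr (pl c)) + (w c : ℚ_[(closureAt v).residueChar]) • Uy u := by
      intro c
      have hr : ∀ r, (A r c : ℚ_[(closureAt v).residueChar]) • y (Sum.inr (pl r)) =
          (if r = c then y (Sum.inr (pl r)) else 0) +
            ((u r : ℚ_[(closureAt v).residueChar]) * (w c : ℚ_[(closureAt v).residueChar])) • y (Sum.inr (pl r)) := by
        intro r
        rw [hent r c, Int.cast_add, Int.cast_mul, add_smul]
        congr 1
        split_ifs <;> simp
      rw [Finset.sum_congr rfl (fun r _ => hr r), Finset.sum_add_distrib, Finset.sum_ite_eq' Finset.univ c,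
        if_pos (Finset.mem_univ c)]
      congr 1
      simp only [Uy, Finset.smul_sum, smul_smul, mul_comm (u _ : ℚ_[(closureAt v).residueChar])]
    rw [show (∑ c : Fin g ⊕ Fin g, y.coord (Sum.inr (Sum.elim (fun i => (i, 0)) (fun i => (i, 1)) c)) z •
        ∑ r : Fin g ⊕ Fin g, (A r c : ℚ_[(closureAt v).residueChar]) •
          y (Sum.inr (Sum.elim (fun i => (i, 0)) (fun i => (i, 1)) r))) =
        ∑ c, cz z c • (y (Sum.inr (pl c)) + (w c : ℚ_[(closureAt v).residueChar]) • Uy u) from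
      Finset.sum_congr rfl fun c _ => by rw [hinner c]]
    simp only [smul_add, Finset.sum_add_distrib, smul_smul]
    rw [← add_assoc, hrec z]
    congr 1
    rw [← Finset.sum_smul]
    simp only [Ω, cz, mul_comm, hwdef]
  have hUy_single : ∀ k : Fin g ⊕ Fin g, Uy (Pi.single k 1) = y (Sum.inr (pl k)) := by
    intro k
    simp only [Uy]
    rw [Finset.sum_eq_single k]
    · simp
    · intro r _ hrk; rw [Pi.single_eq_of_ne hrk, Int.cast_zero, zero_smul]
    · intro h; exact absurd (Finset.mem_univ k) h
  have hΩ_single : ∀ (k : Fin g ⊕ Fin g) (z : RescaledCompletion F (closureAt v).residueChar v hv),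
      Ω (Pi.single k 1) z =
        ((Sum.elim (fun _ => (-1 : ℤ)) (fun _ => (1 : ℤ)) k : ℤ) : ℚ_[(closureAt v).residueChar]) * cz z (Sum.swap k) := by
    intro k z
    simp only [Ω, single_one_vecMul, Matrix.row_apply, J_apply_eq]
    rw [Finset.sum_eq_single (Sum.swap k)]
    · rw [if_pos rfl]
    · intro c _ hc; rw [if_neg hc, Int.cast_zero, zero_mul]
    · intro h; exact absurd (Finset.mem_univ _) h
  have hsgn : ∀ k : Fin g ⊕ Fin g,
      ((Sum.elim (fun _ => (-1 : ℤ)) (fun _ => (1 : ℤ)) k : ℤ) : ℚ_[(closureAt v).residueChar]) ≠ 0 := by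
    rintro (i | i) <;> simp
  -- (T1) every plane vector is trace-zero: `ψ_{T_{e_k}}(y_{k̄}) = y_{k̄} ± y_k` and `ψ` preserves the trace (R13, UNCONDITIONAL)
  have hTr0 : ∀ k : Fin g ⊕ Fin g, Tr (y (Sum.inr (pl k))) = 0 := by
    intro k
    obtain ⟨ψ, hψ, hψf⟩ := hT (Pi.single k 1)
    have h := trace_apply_eq_of_mem_ind1StripOf v hψ (e.symm (y (Sum.inr (pl (Sum.swap k)))))
    change Tr (e (ψ (e.symm (y (Sum.inr (pl (Sum.swap k))))))) = Tr (e (e.symm (y (Sum.inr (pl (Sum.swap k)))))) at h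
    rw [hψf, RingEquiv.apply_symm_apply, map_add, add_eq_left, map_smul, hΩ_single, hUy_single, smul_eq_mul] at h
    have hc1 : cz (y (Sum.inr (pl (Sum.swap k)))) (Sum.swap k) = 1 := by
      change y.coord (Sum.inr (pl (Sum.swap k))) (y (Sum.inr (pl (Sum.swap k)))) = 1
      rw [hcoord, if_pos rfl]
    rw [hc1, mul_one] at h
    exact (mul_eq_zero.mp h).resolve_left (hsgn k)
  -- (T2) `Tr(y_{inl 0}) ≠ 0`: otherwise `Tr ≡ 0`, but `Tr(1) = [K_v:ℚ_p] ≠ 0`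
  haveI : FiniteDimensional ℚ_[(closureAt v).residueChar] (RescaledCompletion F (closureAt v).residueChar v hv) :=
    FiniteDimensional.of_locallyCompactSpace ℚ_[(closureAt v).residueChar]
  have hTr1 : Tr (y (Sum.inl 0)) ≠ 0 := by
    intro h0
    have hall : ∀ s, Tr (y s) = 0 := by
      rintro (t | iε)
      · have ht : t = 0 := Subsingleton.elim _ _
        rw [ht]; exact h0
      · rw [← hpt iε]; exact hTr0 (toSum iε)
    have hzero : Tr = 0 := y.ext fun s => by rw [hall s, LinearMap.zero_apply]
    have h1 : Tr 1 = (Module.finrank ℚ_[(closureAt v).residueChar] (RescaledCompletion F (closureAt v).residueChar v hv) :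
        ℚ_[(closureAt v).residueChar]) := by
      rw [hTr_def, ← map_one (algebraMap ℚ_[(closureAt v).residueChar] (RescaledCompletion F (closureAt v).residueChar v hv)),
        Algebra.trace_algebraMap, nsmul_eq_mul, mul_one]
    rw [hzero, LinearMap.zero_apply, finrank_rescaledCompletion_eq_localDeg] at h1
    have : (localDeg F v : ℚ_[(closureAt v).residueChar]) ≠ 0 := by exact_mod_cast (localDeg_pos F v).ne'
    exact this h1.symm
  -- (T3) the `y_{inl 0}`-coordinate of a trace-zero vector vanishes
  have hc0 : ∀ z, Tr z = 0 → y.coord (Sum.inl 0) z = 0 := by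
    intro z hz
    have h := congrArg Tr (hrec z)
    rw [hz, map_add, map_smul, map_sum] at h
    simp only [map_smul, hTr0, smul_eq_mul, mul_zero, Finset.sum_const_zero, add_zero] at h
    exact (mul_eq_zero.mp h).resolve_right hTr1
  -- (B) the box property of `log_p(𝒪_v^×)` in this basis: plane reach applied to `M = N = log_p(𝒪_v^×)` (strip automorphisms map
  -- `log_p(𝒪_v^×)` onto itself: R9/R17b `sub_mem_smul_logUnits_inter_ker_trace_of_mem_ind1StripOf` with `c = 1`)
  have hLstab : ∀ ψ ∈ ind1StripOf v (galoisLog v), ∀ x : v.adicCompletion F,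
      e x ∈ logUnits (RescaledCompletion F (closureAt v).residueChar v hv) →
        e (ψ x) ∈ logUnits (RescaledCompletion F (closureAt v).residueChar v hv) := by
    intro ψ hψ x hx
    have hx1 : e x ∈ (1 : ℚ_[(closureAt v).residueChar]) • logUnits (RescaledCompletion F (closureAt v).residueChar v hv) := by
      rw [one_smul]; exact hx
    have h := (sub_mem_smul_logUnits_inter_ker_trace_of_mem_ind1StripOf v (closureAt v).residueChar hv hψ 1 hx1).1
    rw [one_smul] at h
    have h' := (logUnitsAddSubgroup (closureAt v).residueChar (RescaledCompletion F (closureAt v).residueChar v hv)).add_mem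
      (show e (ψ x) - e x ∈ logUnitsAddSubgroup _ _ from h) (show e x ∈ logUnitsAddSubgroup _ _ from hx)
    rwa [sub_add_cancel] at h'
  have hbox : ∀ z ∈ logUnits (RescaledCompletion F (closureAt v).residueChar v hv), ∀ j k : Fin g ⊕ Fin g,
      y.coord (Sum.inr (pl j)) z • y (Sum.inr (pl k)) ∈ logUnits (RescaledCompletion F (closureAt v).residueChar v hv) := by
    intro z hz j k
    have h := hreach {x | e x ∈ logUnits (RescaledCompletion F (closureAt v).residueChar v hv)}
      (logUnitsAddSubgroup (closureAt v).residueChar (RescaledCompletion F (closureAt v).residueChar v hv))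
      (fun x hx => hx) (fun ψ hψ x hx => ⟨hLstab ψ hψ x hx, fun ψ' hψ' => hLstab ψ' hψ' _ (hLstab ψ hψ x hx)⟩)
      (e.symm z) (by change e (e.symm z) ∈ _; rw [RingEquiv.apply_symm_apply]; exact hz) j k
    rw [RingEquiv.apply_symm_apply] at h
    exact h
  refine ⟨g, hg, y, hTr0, hTr1, hc0, hbox, hrec, fun c M N hMs hGP hMN horb => ?_⟩
  obtain ⟨x₀, hx₀, j₀, hgp⟩ := hGP
  -- (H1) the floor `c·(log_p(𝒪_v^×) ∩ Ker Tr) ⊆ N`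
  have hfloor : c • (logUnits (RescaledCompletion F (closureAt v).residueChar v hv) ∩ {w | Tr w = 0}) ⊆
      (N : Set (RescaledCompletion F (closureAt v).residueChar v hv)) := by
    rintro _ ⟨z, ⟨hzL, hzT⟩, rfl⟩
    have hzT' : Tr z = 0 := hzT
    have hcz0 : y.coord (Sum.inl 0) (c • z) = 0 := by rw [map_smul, hc0 z hzT', smul_zero]
    change c • z ∈ (N : Set (RescaledCompletion F (closureAt v).residueChar v hv))
    rw [SetLike.mem_coe, ← hrec (c • z), hcz0, zero_smul, zero_add]
    refine N.sum_mem fun k _ => ?_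
    by_cases hj0 : y.coord (Sum.inr (pl j₀)) (e x₀) = 0
    · have hk0 : cz (c • z) k = 0 := by
        have h := hgp z hzL k
        rw [hj0, norm_zero] at h
        exact norm_le_zero_iff.mp h
      rw [hk0, zero_smul]; exact N.zero_mem
    · set u : ℚ_[(closureAt v).residueChar] := cz (c • z) k / y.coord (Sum.inr (pl j₀)) (e x₀) with hu_def
      have hu : ‖u‖ ≤ 1 := by
        rw [hu_def, norm_div, div_le_one (norm_pos_iff.mpr hj0)]
        exact hgp z hzL k
      have hxu : e.symm (u • e x₀) ∈ M := hMs u hu x₀ hx₀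
      have h := hreach M N hMN horb _ hxu j₀ k
      rw [RingEquiv.apply_symm_apply, map_smul, smul_eq_mul, hu_def, div_mul_cancel₀ _ hj0] at h
      exact h
  -- (H2) the container radius is attained inside `N` (co-radial trace-zero element, tame, `[K_v:ℚ_p] ≥ 2`)
  have hd' : 2 ≤ Module.finrank ℚ_[(closureAt v).residueChar] (RescaledCompletion F (closureAt v).residueChar v hv) := by
    rw [finrank_rescaledCompletion_eq_localDeg]; omega
  obtain ⟨w, hwL, hwT, hw, hwmax⟩ := TraceZeroCoradial.exists_mem_logUnits_trace_eq_zero_isMaxOn_of_tame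
    (closureAt v).residueChar (RescaledCompletion F (closureAt v).residueChar v hv) hp2 he hd'
  have hcwN : c • w ∈ N := hfloor (Set.smul_mem_smul_set ⟨hwL, hwT⟩)
  refine ⟨hfloor, ⟨c • w, hcwN, by rw [norm_smul, hw]⟩, fun hMc hNc => ?_⟩
  -- (H3) hull equality: `N` has the container's maximal norm
  have hd2 : 2 ≤ localDeg F v := by omega
  have h0M : (0 : RescaledCompletion F (closureAt v).residueChar v hv) ∈ e '' M := by
    refine ⟨e.symm ((0 : ℚ_[(closureAt v).residueChar]) • e x₀), hMs 0 (by rw [norm_zero]; exact zero_le_one) x₀ hx₀, ?_⟩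
    rw [RingEquiv.apply_symm_apply, zero_smul]
  have hMc' : e '' M ⊆ c • logUnits (RescaledCompletion F (closureAt v).residueChar v hv) := by
    rintro _ ⟨x, hx, rfl⟩; exact hMc x hx
  have hceil := isGreatest_norm_add_inter_ker_of_tame v (closureAt v).residueChar hv hp2 he hd2 c h0M hMc'
  have hN : IsGreatest ((‖·‖) '' (N : Set (RescaledCompletion F (closureAt v).residueChar v hv)))
      (‖c‖ * ((closureAt v).residueChar : ℝ) ^
        (-(1 / (absRamificationIdx (closureAt v).residueChar (RescaledCompletion F (closureAt v).residueChar v hv) : ℝ)))) := by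
    refine ⟨⟨c • w, hcwN, by change ‖c • w‖ = _; rw [norm_smul, hw]⟩, ?_⟩
    rintro _ ⟨n, hn, rfl⟩
    exact hceil.2 ⟨n, hNc hn, rfl⟩
  exact Hull.coe_span_eq_coe_span_of_isGreatest _ (valuedInteger_norm_le_one v _ hv)
    (fun _ h => mem_valuedInteger_of_norm_le_one v _ hv h) hN
    (isGreatest_norm_smul_logUnits_of_tame v _ hv hp2 he hd2 c)

end Summit.ABC.IUTFork.Thm311.Real

end
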